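import Mathlib
import Summits.NavierStokesRegularity.NavierStokesRegularity.Theorems.SubOnsagerCeilingKPSideBranchClassDynamics
import Summits.NavierStokesRegularity.NavierStokesRegularity.Theorems.SubOnsagerCeilingKPFluxBudget
import Summits.NavierStokesRegularity.NavierStokesRegularity.Theorems.SubOnsagerCeilingKPLeakSprayStarvation
import HarnessLib

/-!
# ENERGY STARVATION by a spray of dead-end exits of BOTH kinds (in-shell pumps AND diagonal leaks) — mechanism file 1/2
# (helper file for the crux `SubOnsagerCeiling.ForwardTailCeilingKP`, stmt-NavierStokesRegularity-27057, `--supports`; part 1 of 3)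

THE EXIT-SPRAY CLASS (def-free, by coefficient hypotheses on a KP network proper `α ∈ E₂(R)`: symmetric, cancelling,
orthant, diagonal feeds) unifies the two starvation classes landed before it (`…KPDeadEndPump*`: one in-shell dead-end pump;
`…KPLeakSpray*`: diagonal dead-end leaks): the chain mode `0` (weight `W 0 > 0`) feeds every component `e` one shell up
through its own square with weight `W e ≥ 0` (LEAKS) AND pumps every component `e ≠ 0` in-shell through its own square with
weight `P e ≥ 0` (PUMPS, `P 0 = 0`); the components `e ≠ 0` are dead ends (no feeds out of them, no other in-shell triads).

* (`leakSpray_feedSum / _drainSum / _gateFlux` are reused from the leak-spray file;) `exitSpray_coeff`, `exitSpray_inShell` — the in-shell coefficient table of the class and its quadratic form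
  (`Σ_{a,b} α a b i (0,0,0) y_a y_b = [i = 0]·(−y_0 Σ_b P b y_b) + [i ≠ 0]·P i y_0²`);
* `exitSpray_quadTerm_chain / _exit` — closed forms from the normal form `kpProper_quadTerm`;
* `exitSpray_pocket_ge` — the TWO-TERM comparison `x_{e,N} ≥ (W e/W 0)·x_{0,N} + (P e/W 0)·x_{0,N+1}` on `[0,s]`, `N ≥ 1`, `e ≠ 0`;
* (sequel `Theorems/SubOnsagerCeilingKPExitSprayFlux.lean`) `exitSpray_outflux_le_influx`, `exitSpray_flux_step`
  (`(1 + r)·Φ_{m+2} ≤ Φ_{m+1}`, `r = (Σ_{e≠0} W e² + Σ_e P e²)/W 0²`), `exitSpray_flux_le` (`Φ_{m+1} ≤ E₀ q^m`).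

The file `Theorems/SubOnsagerCeilingKPExitSprayBarrier.lean` turns this into `ShellBarrierAt R ε₀ α` with `(1+ε₀)^{2θ} = 1 + r`,
`D = (1+r)²`, at EVERY scale ratio — `θ > 1/2` iff `Σ_{e≠0} W e² + Σ_e P e² > ε₀·W 0²`: dead-end exits of both kinds add up.
HONEST FRAMING: statements about Tao-type MODEL lattice ODEs (route SubOnsagerCeiling, rung TL-M2Break); one
architecture class; no stub, crux or summit is proved and nothing here bears on Navier–Stokes regularity.
[cite: Tao2016AveragedNS, §4 (4.2)–(4.3), (4.8), (4.13)] [cite: Teschl2012, §2.4 (Grönwall)]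
-/

noncomputable section

-- the sub-problem namespace `NavierStokesRegularity.NavierStokesRegularity` is the tree's layout (D-0017)
set_option linter.dupNamespace false

namespace Summit.NavierStokesRegularity.NavierStokesRegularity.Theorems

open Set Finset MeasureTheory intervalIntegral
open scoped Topology
open Literature.Analysis.FluidPDE.TaoCascade

section ExitSpray

variable {α : Fin 4 → Fin 4 → Fin 4 → ℤ × ℤ × ℤ → ℝ} {W P : Fin 4 → ℝ}

variable (hs : IsSymmetricCoeff α) (hc : IsCancellingCoeff α)
  (hO : ∀ (Y : Fin 4 → ℤ → ℝ → ℝ) (τ : ℝ), (∀ (j : Fin 4) (k : ℤ), 1 ≤ k → 0 ≤ Y j k τ) →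
    ∀ δ : ℝ, 0 < δ → ∀ (i : Fin 4) (n : ℤ), 1 ≤ n → Y i n τ = 0 → 0 ≤ quadTerm δ α Y i n τ)
  (hD : ∀ a b i : Fin 4, a ≠ b → α a b i (0, 0, 1) = 0)
  (hW : ∀ a i : Fin 4, α a a i (0, 0, 1) = if a = 0 then W i else 0)
  (hP : ∀ a c : Fin 4, a ≠ c → α a a c (0, 0, 0) = if a = 0 then P c else 0) (hP0 : P 0 = 0)
  (hCz : ∀ a b c : Fin 4, a ≠ b → a ≠ c → b ≠ c → α a b c (0, 0, 0) = 0)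
include hs hc hO hD hW hP hP0 hCz

omit hO hD hW hP0 in
/-- The in-shell coefficient table of the exit-spray class: the pump `P i` at `(0,0,i)`, its back-reactions `−P b/2` at
`(0,b,0)` and `−P a/2` at `(a,0,0)`, nothing else (`P 0 = 0`). [this file] -/
theorem exitSpray_coeff (a b i : Fin 4) :
    α a b i (0, 0, 0) = (if a = 0 ∧ b = 0 then P i else 0) + (if a = 0 ∧ i = 0 then -(P b) / 2 else 0) +
      (if b = 0 ∧ i = 0 then -(P a) / 2 else 0) := by
  have hdiag : ∀ e : Fin 4, α e e e (0, 0, 0) = 0 := fun e => kpProper_inShell_diag_zero hc e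
  have hback : ∀ e j : Fin 4, e ≠ j → α e j e (0, 0, 0) = -(α e e j (0, 0, 0)) / 2 := by
    intro e j hej
    have h1 := kpProper_inShell_back hc e j
    have h2 : α j e e (0, 0, 0) = α e j e (0, 0, 0) := hs j e e 0 0 0 kpProper_mem000
    linarith
  have hback' : ∀ e j : Fin 4, e ≠ j → α j e e (0, 0, 0) = -(α e e j (0, 0, 0)) / 2 := by
    intro e j hej
    rw [hs j e e 0 0 0 kpProper_mem000, hback e j hej]
  fin_cases a <;> fin_cases b <;> fin_cases i <;>
    first
      | (rw [hdiag]; simp; ring)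
      | (rw [hdiag]; simp)
      | (rw [hCz _ _ _ (by decide) (by decide) (by decide)]; simp)
      | (rw [hP _ _ (by decide)]; simp)
      | (rw [hback _ _ (by decide), hP _ _ (by decide)]; simp)
      | (rw [hback' _ _ (by decide), hP _ _ (by decide)]; simp)

omit hO hD hW in
/-- The in-shell quadratic form of component `i`: `−y_0 Σ_b P b y_b` on the chain, `P i·y_0²` on an exit. [this file] -/
theorem exitSpray_inShell (y : Fin 4 → ℝ) (i : Fin 4) :
    ∑ a, ∑ b, α a b i (0, 0, 0) * (y a * y b) =
      (if i = 0 then -(y 0 * ∑ b, P b * y b) else 0) + (if i = 0 then 0 else P i * (y 0 * y 0)) := by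
  simp only [exitSpray_coeff hs hc hP hCz, Fin.sum_univ_four]
  fin_cases i
  · simp [hP0]
    ring
  · simp
  · simp
  · simp

/-- **Chain component**: `quadTerm₀(n) = W₀Λ_{n-1}x²_{0,n-1} − Λₙ x_{0,n}(Σ_j W j X_{j,n+1} + Σ_b P b X_{b,n})`. [this file] -/
theorem exitSpray_quadTerm_chain (ε₀ : ℝ) (X : Fin 4 → ℤ → ℝ → ℝ) (n : ℤ) (t : ℝ) :
    quadTerm ε₀ α X 0 n t =
      W 0 * (1 + ε₀) ^ ((5 : ℝ) * ((n : ℝ) - 1) / 2) * X 0 (n - 1) t ^ 2 -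
        (1 + ε₀) ^ ((5 : ℝ) * n / 2) *
          (X 0 n t * (∑ j, W j * X j (n + 1) t + ∑ b, P b * X b n t)) := by
  rw [kpProper_quadTerm hs hc hO hD, leakSpray_feedSum hW (fun a => X a (n - 1) t) 0,
    leakSpray_drainSum hW (fun j => X j (n + 1) t) 0, exitSpray_inShell hs hc hP hP0 hCz (fun j => X j n t) 0]
  simp
  ring

/-- **Exit** `e ≠ 0`: `quadTerm_e(n) = W e·Λ_{n-1}x²_{0,n-1} + P e·Λₙ x²_{0,n}` (fed by the chain in both ways, feeds nothing).
[this file] -/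
theorem exitSpray_quadTerm_exit (ε₀ : ℝ) (X : Fin 4 → ℤ → ℝ → ℝ) {e : Fin 4} (he : e ≠ 0) (n : ℤ) (t : ℝ) :
    quadTerm ε₀ α X e n t = W e * (1 + ε₀) ^ ((5 : ℝ) * ((n : ℝ) - 1) / 2) * X 0 (n - 1) t ^ 2 +
      P e * (1 + ε₀) ^ ((5 : ℝ) * n / 2) * (X 0 n t * X 0 n t) := by
  rw [kpProper_quadTerm hs hc hO hD, leakSpray_feedSum hW (fun a => X a (n - 1) t) e,
    leakSpray_drainSum hW (fun j => X j (n + 1) t) e, exitSpray_inShell hs hc hP hP0 hCz (fun j => X j n t) e]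
  simp [he]
  ring

/-- **The exits dominate the chain amplitudes** (two-term comparison): along an honest non-negative `ν`-viscous solution
from a one-shell datum (`W, P ≥ 0`, `W 0 > 0`, `ε₀ ≥ 0`), for every shell `N ≥ 1`, every `e ≠ 0` and `t ∈ [0,s]`:
`(W e/W 0)·x_{0,N}(t) + (P e/W 0)·x_{0,N+1}(t) ≤ x_{e,N}(t)` (`u = x_{e,N} − (W e/W 0)x_{0,N} − (P e/W 0)x_{0,N+1}` has
`u(0) = 0` and `u' + ν(1+ε₀)^{2N}u ≥ 0`). [cite: Teschl2012, §2.4 (Grönwall)] -/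
theorem exitSpray_pocket_ge {ε₀ ν s : ℝ} (hε : 0 ≤ ε₀) (hν : 0 ≤ ν) (hW0 : 0 < W 0) (hWnn : ∀ i, 0 ≤ W i)
    (hPnn : ∀ i, 0 ≤ P i) {X₀ : Fin 4 → ℝ} {X : Fin 4 → ℤ → ℝ → ℝ}
    (hdat : ∀ (i : Fin 4) (k : ℤ), X i k 0 = if k = 0 then X₀ i else 0)
    (hode : ∀ (i : Fin 4) (k : ℤ), ∀ t ∈ Icc (0 : ℝ) s, HasDerivWithinAt (X i k)
      (quadTerm ε₀ α X i k t - ν * (1 + ε₀) ^ ((2 : ℝ) * k) * X i k t) (Icc (0 : ℝ) s) t)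
    (hnn : ∀ t ∈ Icc (0 : ℝ) s, ∀ (i : Fin 4) (k : ℤ), 1 ≤ k → 0 ≤ X i k t)
    {e : Fin 4} (he : e ≠ 0) {N : ℤ} (hN : 1 ≤ N) :
    ∀ t ∈ Icc (0 : ℝ) s, W e / W 0 * X 0 N t + P e / W 0 * X 0 (N + 1) t ≤ X e N t := by
  set κ : ℝ := ν * (1 + ε₀) ^ ((2 : ℝ) * N) with hκ
  set κ' : ℝ := ν * (1 + ε₀) ^ ((2 : ℝ) * ((N + 1 : ℤ) : ℝ)) with hκ'
  have hb1 : (1 : ℝ) ≤ 1 + ε₀ := by linarith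
  have hκκ' : κ ≤ κ' := by
    simp only [hκ, hκ']
    refine mul_le_mul_of_nonneg_left (Real.rpow_le_rpow_of_exponent_le hb1 ?_) hν
    push_cast
    linarith
  -- total drains of the chain mode at shells `N` and `N+1`
  set T : ℝ → ℝ := fun τ => ∑ j, W j * X j (N + 1) τ + ∑ b, P b * X b N τ with hT
  set T' : ℝ → ℝ := fun τ => ∑ j, W j * X j (N + 1 + 1) τ + ∑ b, P b * X b (N + 1) τ with hT'
  have hTnn : ∀ τ ∈ Icc (0 : ℝ) s, 0 ≤ T τ := fun τ hτ =>
    add_nonneg (Finset.sum_nonneg fun j _ => mul_nonneg (hWnn j) (hnn τ hτ j _ (by omega)))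
      (Finset.sum_nonneg fun j _ => mul_nonneg (hPnn j) (hnn τ hτ j _ hN))
  have hT'nn : ∀ τ ∈ Icc (0 : ℝ) s, 0 ≤ T' τ := fun τ hτ =>
    add_nonneg (Finset.sum_nonneg fun j _ => mul_nonneg (hWnn j) (hnn τ hτ j _ (by omega)))
      (Finset.sum_nonneg fun j _ => mul_nonneg (hPnn j) (hnn τ hτ j _ (by omega)))
  set u : ℝ → ℝ := fun τ => X e N τ - W e / W 0 * X 0 N τ - P e / W 0 * X 0 (N + 1) τ with hu
  set u' : ℝ → ℝ := fun τ =>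
    (W e * (1 + ε₀) ^ ((5 : ℝ) * ((N : ℝ) - 1) / 2) * X 0 (N - 1) τ ^ 2 +
        P e * (1 + ε₀) ^ ((5 : ℝ) * N / 2) * (X 0 N τ * X 0 N τ) - κ * X e N τ) -
      W e / W 0 * (W 0 * (1 + ε₀) ^ ((5 : ℝ) * ((N : ℝ) - 1) / 2) * X 0 (N - 1) τ ^ 2 -
        (1 + ε₀) ^ ((5 : ℝ) * N / 2) * (X 0 N τ * T τ) - κ * X 0 N τ) -
      P e / W 0 * (W 0 * (1 + ε₀) ^ ((5 : ℝ) * (((N + 1 : ℤ) : ℝ) - 1) / 2) * X 0 (N + 1 - 1) τ ^ 2 -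
        (1 + ε₀) ^ ((5 : ℝ) * ((N + 1 : ℤ) : ℝ) / 2) * (X 0 (N + 1) τ * T' τ) - κ' * X 0 (N + 1) τ) with hu'
  have hud : ∀ τ ∈ Icc (0 : ℝ) s, HasDerivWithinAt u (u' τ) (Icc 0 s) τ := by
    intro τ hτ
    have h1 := hode e N τ hτ
    rw [exitSpray_quadTerm_exit hs hc hO hD hW hP hP0 hCz ε₀ X he] at h1
    have h0 := hode 0 N τ hτ
    rw [exitSpray_quadTerm_chain hs hc hO hD hW hP hP0 hCz] at h0
    have h0' := hode 0 (N + 1) τ hτ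
    rw [exitSpray_quadTerm_chain hs hc hO hD hW hP hP0 hCz] at h0'
    exact (h1.sub (h0.const_mul (W e / W 0))).sub (h0'.const_mul (P e / W 0))
  have hkey : ∀ τ ∈ Icc (0 : ℝ) s, 0 ≤ u' τ + κ * u τ := by
    intro τ hτ
    have hx : 0 ≤ X 0 N τ := hnn τ hτ 0 _ hN
    have hx1 : 0 ≤ X 0 (N + 1) τ := hnn τ hτ 0 _ (by omega)
    have hsimp : u' τ + κ * u τ =
        W e / W 0 * ((1 + ε₀) ^ ((5 : ℝ) * N / 2) * (X 0 N τ * T τ)) +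
          P e / W 0 * ((1 + ε₀) ^ ((5 : ℝ) * ((N + 1 : ℤ) : ℝ) / 2) * (X 0 (N + 1) τ * T' τ)) +
          P e / W 0 * (κ' - κ) * X 0 (N + 1) τ := by
      have hidx : (N + 1 - 1 : ℤ) = N := by omega
      have hexp : ((5 : ℝ) * ((((N + 1 : ℤ)) : ℝ) - 1) / 2) = (5 : ℝ) * N / 2 := by push_cast; ring
      simp only [hu, hu', hidx, hexp]
      field_simp
      ring
    rw [hsimp]
    have hWe : 0 ≤ W e / W 0 := div_nonneg (hWnn e) hW0.le
    have hPe : 0 ≤ P e / W 0 := div_nonneg (hPnn e) hW0.le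
    have hΛ : 0 ≤ (1 + ε₀) ^ ((5 : ℝ) * N / 2) := Real.rpow_nonneg (by linarith) _
    have hΛ' : 0 ≤ (1 + ε₀) ^ ((5 : ℝ) * ((N + 1 : ℤ) : ℝ) / 2) := Real.rpow_nonneg (by linarith) _
    have h1 : 0 ≤ W e / W 0 * ((1 + ε₀) ^ ((5 : ℝ) * N / 2) * (X 0 N τ * T τ)) :=
      mul_nonneg hWe (mul_nonneg hΛ (mul_nonneg hx (hTnn τ hτ)))
    have h2 : 0 ≤ P e / W 0 * ((1 + ε₀) ^ ((5 : ℝ) * ((N + 1 : ℤ) : ℝ) / 2) * (X 0 (N + 1) τ * T' τ)) :=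
      mul_nonneg hPe (mul_nonneg hΛ' (mul_nonneg hx1 (hT'nn τ hτ)))
    have h3 : 0 ≤ P e / W 0 * (κ' - κ) * X 0 (N + 1) τ := mul_nonneg (mul_nonneg hPe (by linarith)) hx1
    linarith
  -- `G = e^{κ t} u` is monotone on `[0,s]`
  set G : ℝ → ℝ := fun τ => Real.exp (κ * τ) * u τ with hG
  set G' : ℝ → ℝ := fun τ => Real.exp (κ * τ) * (u' τ + κ * u τ) with hG'
  have hGd : ∀ τ ∈ Icc (0 : ℝ) s, HasDerivWithinAt G (G' τ) (Icc 0 s) τ := by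
    intro τ hτ
    have hexp : HasDerivWithinAt (fun θ => Real.exp (κ * θ)) (Real.exp (κ * τ) * κ) (Icc 0 s) τ := by
      have := ((hasDerivAt_id τ).const_mul κ).exp
      simpa using this.hasDerivWithinAt
    have h := hexp.mul (hud τ hτ)
    refine h.congr_deriv ?_
    simp only [hG']
    ring
  have hGmono : MonotoneOn G (Icc 0 s) := by
    have hGcont : ContinuousOn G (Icc 0 s) := fun τ hτ => (hGd τ hτ).continuousWithinAt
    refine monotoneOn_of_hasDerivWithinAt_nonneg (f' := G') (convex_Icc 0 s) hGcont ?_ ?_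
    · intro x hx
      rw [interior_Icc] at hx ⊢
      exact (hGd x (Ioo_subset_Icc_self hx)).mono Ioo_subset_Icc_self
    · intro x hx
      rw [interior_Icc] at hx
      exact mul_nonneg (Real.exp_pos _).le (hkey x (Ioo_subset_Icc_self hx))
  have hG0 : G 0 = 0 := by
    have h1 : X e N 0 = 0 := by rw [hdat]; simp; omega
    have h2 : X 0 N 0 = 0 := by rw [hdat]; simp; omega
    have h3 : X 0 (N + 1) 0 = 0 := by rw [hdat]; simp; omega
    simp [hG, hu, h1, h2, h3]
  intro t ht
  have hGt : 0 ≤ G t := by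
    rw [← hG0]
    exact hGmono ⟨le_rfl, ht.1.trans ht.2⟩ ht ht.1
  have hexp : 0 < Real.exp (κ * t) := Real.exp_pos _
  have hut : 0 ≤ u t := by
    by_contra hh
    push Not at hh
    have : G t < 0 := by simp only [hG]; nlinarith [mul_pos hexp (neg_pos.2 hh)]
    linarith
  simp only [hu] at hut
  linarith

end ExitSpray

end Summit.NavierStokesRegularity.NavierStokesRegularity.Theorems

end
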